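import Literature.NumberTheory.Transcendental.QuadraticRelationsLogarithmsSec6IVa
import Literature.NumberTheory.Transcendental.QuadraticRelationsLogarithmsSec6IVb
import HarnessLib

/-!
# Roy–Waldschmidt 1997, §6 (iv) (b): Théorème 1.1 from Théorème 5.1

D. Roy, M. Waldschmidt, Ann. Sci. ÉNS (4) 30 (1997) 753–796, §6 (iv) (b), pp. 789–790: "Puisque
l'énoncé 1 de la proposition 6.1 est vérifié dans la catégorie `𝒞_ε` … l'énoncé 2 … est lui-aussi
vérifié … Plaçons-nous maintenant dans les hypothèses du théorème 1.1 …".  With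
`X = (d₀, d₁, W, Y, Y_a)`, `ε⁻¹ = N = 2d(d + ℓ₁) + 1`, `X ∈ 𝒞_ε`, `d > 2n ⟹ b_ε(X) > 0`; a
minimiser `s : X → X'` of `a_ε/b_ε` with `r_ε(X')` minimal has `κ(X') = κ_a(X') = 0` (Lemme 6.4);
`g` the linear map underlying `s`; `n' ≥ d₀'` and `n' > 0` by the hypothesis on `T₀ × T₁`
(pulling back `T₀' × T₁'` by `g`); `b_ε(X') ≠ 0` gives `d' ≥ 2n'`, `d₁' ≥ n' > 0`; (6.5) and the
choice of `ε` give `d' > 2n'`, `d₁/(d-2n) ≥ d₁'/(d'-2n') ≥ ℓ₁'/(2n'-ℓ₀')`, strict if `d₀' < n'` or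
`ℓ₀' < n'` or `ℓ_a' > 0`.

* `RoyWaldschmidt1997.thm_1_1_of_h51` — **Théorème 1.1 for a field `K`, from Théorème 5.1 for
  `K`** in the tangent-space form `h51` of `…Sec6IVa.lean` (everything else — Proposition 6.1, the
  category `𝒞`, Lemmes 6.2–6.4 — being proved).  The conclusion is stated exactly as the
  hypothesis `h11` of `…Thm11.lean` (Théorème 1.1 verbatim) specialised to `K`.

No definitions, no named facts.

## References

* [RoyWaldschmidt1997ENS] D. Roy, M. Waldschmidt, Ann. Sci. ÉNS (4) 30 (1997) 753–796,
  Théorème 1.1 pp. 755–756; §6 (iv) (b) pp. 789–790 (read on the rendered scan).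
-/

noncomputable section

open Complex IntermediateField Module Submodule

namespace Literature.NumberTheory.Transcendental

namespace RoyWaldschmidt1997

open LiePresentation

variable {K : IntermediateField ℚ ℂ}

/-! ### Surjective structure maps are surjective on `K`-points and on `ℚ`-points -/

/-- A surjective map defined over `K` is surjective on `K`-points. [folklore] -/
theorem surjOn_kPoints {a b : ℕ} (g₀ : (Fin a → ℂ) →ₗ[ℂ] (Fin b → ℂ)) (g₀K : (Fin a → K) →ₗ[K] (Fin b → K))
    (hg₀ : ∀ c, g₀ (ofK K c) = ofK K (g₀K c)) (hsurj : Function.Surjective g₀) :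
    Function.Surjective g₀K := by
  classical
  rw [← LinearMap.range_eq_top]
  apply Submodule.eq_top_of_finrank_eq
  have h1 := finrank_span_ofK (K := K) (L := ℂ) (LinearMap.range g₀K)
  rw [LinearMap.coe_range, ← range_eq_span_of_ofK g₀ g₀K hg₀, LinearMap.range_eq_top.mpr hsurj, finrank_top,
    Module.finrank_fin_fun] at h1
  rw [← h1, Module.finrank_fin_fun]

/-- A surjective map defined over `ℚ` is surjective on rational points. [folklore] -/
theorem surjOn_ratPoints {a b : ℕ} (g₁ : (Fin a → ℂ) →ₗ[ℂ] (Fin b → ℂ)) (g₁₀ : (Fin a → ℚ) →ₗ[ℚ] (Fin b → ℚ))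
    (hg₁ : ∀ q : Fin a → ℚ, g₁ (fun j => ((q j : ℚ) : ℂ)) = fun i => ((g₁₀ q i : ℚ) : ℂ))
    (hsurj : Function.Surjective g₁) : Function.Surjective g₁₀ := by
  classical
  rw [← LinearMap.range_eq_top]
  apply Submodule.eq_top_of_finrank_eq
  have h1 := finrank_span_ofK (K := ℚ) (L := ℂ) (LinearMap.range g₁₀)
  rw [LinearMap.coe_range, ← range_eq_span_of_rat g₁ g₁₀ hg₁, LinearMap.range_eq_top.mpr hsurj, finrank_top,
    Module.finrank_fin_fun] at h1
  rw [← h1, Module.finrank_fin_fun]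

/-- **The image conditions of Théorème 1.1** for a surjective morphism of `𝒞`:
`g(K^{d₀} × 0) = K^{d₀'} × 0` and `g(0 × ℚ^{d₁}) = 0 × ℚ^{d₁'}`. [cite: RoyWaldschmidt1997ENS, p. 759 and p. 790] -/
theorem IsStruct.image_eqs {d₀ d₁ d₀' d₁' : ℕ}
    {g : ((Fin d₀ → ℂ) × (Fin d₁ → ℂ)) →ₗ[ℂ] ((Fin d₀' → ℂ) × (Fin d₁' → ℂ))} (hg : IsStruct K g)
    (hsurj : Function.Surjective g) :
    g '' {p | (∀ i, p.1 i ∈ K) ∧ p.2 = 0} = {q | (∀ i, q.1 i ∈ K) ∧ q.2 = 0} ∧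
    g '' {p | p.1 = 0 ∧ ∀ j, p.2 j ∈ Set.range ((↑) : ℚ → ℂ)} =
      {q | q.1 = 0 ∧ ∀ j, q.2 j ∈ Set.range ((↑) : ℚ → ℂ)} := by
  classical
  obtain ⟨g₀, g₁, g₀K, g₁₀, hgap, hg₀K, hg₁₀⟩ := hg.exists_block
  obtain ⟨hg₀surj, hg₁surj⟩ := block_surjective hgap hsurj
  have hK := surjOn_kPoints g₀ g₀K hg₀K hg₀surj
  have hQ := surjOn_ratPoints g₁ g₁₀ hg₁₀ hg₁surj
  constructor
  · ext q
    constructor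
    · rintro ⟨p, ⟨hp1, hp2⟩, rfl⟩
      obtain ⟨c, hc⟩ := exists_ofK_of_mem K hp1
      refine ⟨fun i => ?_, ?_⟩
      · rw [hgap]; simp only; rw [hc, hg₀K]; simp [ofK_apply]
      · rw [hgap]; simp [hp2]
    · rintro ⟨hq1, hq2⟩
      obtain ⟨c', hc'⟩ := exists_ofK_of_mem K hq1
      obtain ⟨c, rfl⟩ := hK c'
      refine ⟨(ofK K c, 0), ⟨fun i => by simp [ofK_apply], rfl⟩, ?_⟩
      rw [hgap]; ext1
      · simp only; rw [hg₀K, hc']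
      · simp only [map_zero]; exact hq2.symm
  · ext q
    constructor
    · rintro ⟨p, ⟨hp1, hp2⟩, rfl⟩
      choose r hr using hp2
      have hp2' : p.2 = fun j => ((r j : ℚ) : ℂ) := funext fun j => (hr j).symm
      refine ⟨?_, fun j => ?_⟩
      · rw [hgap]; simp [hp1]
      · rw [hgap]; simp only; rw [hp2', hg₁₀]; exact ⟨_, rfl⟩
    · rintro ⟨hq1, hq2⟩
      choose r hr using hq2
      have hq2' : q.2 = fun j => ((r j : ℚ) : ℂ) := funext fun j => (hr j).symm
      obtain ⟨r₀, rfl⟩ := hQ r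
      refine ⟨(0, fun j => ((r₀ j : ℚ) : ℂ)), ⟨rfl, fun j => ⟨_, rfl⟩⟩, ?_⟩
      rw [hgap]; ext1
      · simp only [map_zero]; exact hq1.symm
      · simp only; rw [hg₁₀, hq2']

/-! ### From the `ℕ`-valued functions to the integer inequalities of `…Sec6IVb` -/

/-- `a(X₁) b(X) ≤ a(X) b(X₁)` (with `κ(X₁) = κ_a(X₁) = 0`) in the form required by `left_ineq_6_5`.
[cite: RoyWaldschmidt1997ENS, §6 (iv) (b), p. 790] -/
theorem left_input {N a0 a1 n k ka b0 b1 m : ℕ} (hN1 : 1 ≤ N)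
    (hbX : (2 * N ^ 2 - N) * n < (N ^ 2 - N) * a0 + N ^ 2 * a1)
    (hb₁ : (2 * N ^ 2 - N) * m < (N ^ 2 - N) * b0 + N ^ 2 * b1) (hk : k ≤ a1)
    (hab : N ^ 2 * b1 * ((N ^ 2 - N) * a0 + N ^ 2 * a1 + ka - (2 * N ^ 2 - N) * n) ≤
      N ^ 2 * (a1 - k) * ((N ^ 2 - N) * b0 + N ^ 2 * b1 - (2 * N ^ 2 - N) * m)) :
    (b1 : ℤ) * ((N : ℤ) ^ 2 * (a0 + a1 - 2 * n) + N * (n - a0)) ≤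
      a1 * ((N : ℤ) ^ 2 * (b0 + b1 - 2 * m) + N * (m - b0)) := by
  have hNN : N ≤ N ^ 2 := by nlinarith
  have hNN2 : N ≤ 2 * N ^ 2 := by nlinarith
  have hbX' : (2 * N ^ 2 - N) * n ≤ (N ^ 2 - N) * a0 + N ^ 2 * a1 + ka := by omega
  zify [hNN, hNN2, hbX', hb₁.le, hk] at hab
  have hB₁ : (0 : ℤ) < ((N : ℤ) ^ 2 - N) * b0 + (N : ℤ) ^ 2 * b1 - (2 * (N : ℤ) ^ 2 - N) * m := by
    have := hb₁; zify [hNN, hNN2] at this; linarith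
  have hN2 : (0 : ℤ) < (N : ℤ) ^ 2 := by positivity
  have hka : (0 : ℤ) ≤ ka := Nat.cast_nonneg _
  have hk0 : (0 : ℤ) ≤ k := Nat.cast_nonneg _
  have hb1 : (0 : ℤ) ≤ b1 := Nat.cast_nonneg _
  have e1 : ((N : ℤ) ^ 2 - N) * a0 + (N : ℤ) ^ 2 * a1 + ka - (2 * (N : ℤ) ^ 2 - N) * n =
      (N : ℤ) ^ 2 * (a0 + a1 - 2 * n) + N * (n - a0) + ka := by ring
  have e2 : ((N : ℤ) ^ 2 - N) * b0 + (N : ℤ) ^ 2 * b1 - (2 * (N : ℤ) ^ 2 - N) * m =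
      (N : ℤ) ^ 2 * (b0 + b1 - 2 * m) + N * (m - b0) := by ring
  have s1 : (b1 : ℤ) * ((N : ℤ) ^ 2 * (a0 + a1 - 2 * n) + N * (n - a0)) ≤
      b1 * (((N : ℤ) ^ 2 - N) * a0 + (N : ℤ) ^ 2 * a1 + ka - (2 * (N : ℤ) ^ 2 - N) * n) := by
    rw [e1]; nlinarith
  have s2 : (N : ℤ) ^ 2 * ((b1 : ℤ) * (((N : ℤ) ^ 2 - N) * a0 + (N : ℤ) ^ 2 * a1 + ka - (2 * (N : ℤ) ^ 2 - N) * n)) ≤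
      (N : ℤ) ^ 2 * (a1 * (((N : ℤ) ^ 2 - N) * b0 + (N : ℤ) ^ 2 * b1 - (2 * (N : ℤ) ^ 2 - N) * m)) := by
    nlinarith [hab, mul_nonneg hN2.le (mul_nonneg hk0 hB₁.le)]
  have s3 := le_of_mul_le_mul_left s2 hN2
  rw [e2] at s3
  exact s1.trans s3

/-- `c(X₁) b(X₁) ≤ a(X₁) d(X₁)` (with `κ(X₁) = κ_a(X₁) = 0`, and trivially when `ℓ₁(X₁) = 0`) in the
form required by `right_ineq_6_5`. [cite: RoyWaldschmidt1997ENS, §6 (iv) (b), p. 790] -/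
theorem right_input {N b0 b1 m l0 l1 la : ℕ} (hN1 : 1 ≤ N)
    (hb₁ : (2 * N ^ 2 - N) * m < (N ^ 2 - N) * b0 + N ^ 2 * b1)
    (hdE : (N ^ 2 - N) * l0 + la ≤ (2 * N ^ 2 - N) * m)
    (hcd : l1 ≠ 0 → N ^ 2 * l1 * ((N ^ 2 - N) * b0 + N ^ 2 * b1 - (2 * N ^ 2 - N) * m) ≤
      N ^ 2 * b1 * ((2 * N ^ 2 - N) * m - ((N ^ 2 - N) * l0 + la))) :
    (l1 : ℤ) * ((N : ℤ) ^ 2 * (b0 + b1 - 2 * m) + N * (m - b0)) ≤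
      b1 * ((N : ℤ) ^ 2 * (2 * m - l0) - N * (m - l0) - la) := by
  have hNN : N ≤ N ^ 2 := by nlinarith
  have hNN2 : N ≤ 2 * N ^ 2 := by nlinarith
  have hN2 : (0 : ℤ) < (N : ℤ) ^ 2 := by positivity
  have e2 : ((N : ℤ) ^ 2 - N) * b0 + (N : ℤ) ^ 2 * b1 - (2 * (N : ℤ) ^ 2 - N) * m =
      (N : ℤ) ^ 2 * (b0 + b1 - 2 * m) + N * (m - b0) := by ring
  have e3 : (2 * (N : ℤ) ^ 2 - N) * m - (((N : ℤ) ^ 2 - N) * l0 + la) =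
      (N : ℤ) ^ 2 * (2 * m - l0) - N * (m - l0) - la := by ring
  rcases Nat.eq_zero_or_pos l1 with hl | hl
  · rw [hl]; push_cast; simp only [zero_mul]
    have := hdE; zify [hNN, hNN2] at this
    have hb1 : (0 : ℤ) ≤ b1 := Nat.cast_nonneg _
    rw [← e3]
    exact mul_nonneg hb1 (by linarith)
  · have h := hcd (by omega)
    zify [hNN, hNN2, hb₁.le, hdE] at h
    have s2 : (N : ℤ) ^ 2 * ((l1 : ℤ) * (((N : ℤ) ^ 2 - N) * b0 + (N : ℤ) ^ 2 * b1 - (2 * (N : ℤ) ^ 2 - N) * m)) ≤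
        (N : ℤ) ^ 2 * (b1 * ((2 * (N : ℤ) ^ 2 - N) * m - (((N : ℤ) ^ 2 - N) * l0 + la))) := by
      linarith [h]
    have s3 := le_of_mul_le_mul_left s2 hN2
    rw [e2, e3] at s3
    exact s3

/-! ### `n' ≥ d₀'` and `n' > 0` from the hypothesis on `T₀ × T₁` -/

set_option maxHeartbeats 800000 in
/-- **The hypothesis of Théorème 1.1 forces `n' ≥ d₀'` and `n' > 0`** for every cokernel
`X → X'` with `d' > 0` (p. 790): otherwise `W'` and `Y'` lie in a proper `T₀' × T₁'` and `W, Y` in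
its preimage `g⁻¹(T₀' × T₁') = T₀ × T₁ ≠ ℂ^d`. [cite: RoyWaldschmidt1997ENS, §6 (iv) (b), p. 790] -/
theorem quot_nn_facts (X X₁ : RWObj K)
    (g : ((Fin X.d₀ → ℂ) × (Fin X.d₁ → ℂ)) →ₗ[ℂ] ((Fin X₁.d₀ → ℂ) × (Fin X₁.d₁ → ℂ)))
    (hcoker : IsCoker X X₁ g)
    (hirr : ∀ (T₀ : Submodule ℂ (Fin X.d₀ → ℂ)) (T₁ : Submodule ℂ (Fin X.d₁ → ℂ)),
        IsKRational K T₀ → (∃ s : Set (Fin X.d₁ → ℚ), T₁ = ratSpan s) →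
        (∀ w ∈ X.W, w.1 ∈ T₀ ∧ w.2 ∈ T₁) → (∀ y ∈ X.Y, y.1 ∈ T₀ ∧ y.2 ∈ T₁) → T₀ = ⊤ ∧ T₁ = ⊤) :
    X₁.dd₀ ≤ X₁.nn ∧ (X₁.nn = 0 → X₁.d₀ = 0 ∧ X₁.d₁ = 0) := by
  classical
  obtain ⟨⟨hstruct, -, -, -⟩, hsurj, eW, eY, -⟩ := hcoker
  obtain ⟨g₀, g₁, g₀K, g₁₀, hgap, hg₀K, hg₁₀⟩ := hstruct.exists_block
  obtain ⟨hg₀surj, -⟩ := block_surjective hgap hsurj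
  set S₁ := span ℂ ((X₁.W : Set ((Fin X₁.d₀ → ℂ) × (Fin X₁.d₁ → ℂ))) ∪ (X₁.Y : Set _)) with hS₁
  have hWS : ∀ w ∈ X.W, g w ∈ S₁ := fun w hw => subset_span (Or.inl (by rw [← eW]; exact ⟨w, hw, rfl⟩))
  have hYS : ∀ y ∈ X.Y, g y ∈ S₁ := fun y hy => subset_span (Or.inr (by rw [← eY]; exact ⟨y, hy, rfl⟩))
  constructor
  · -- `T₀' = π₀(ℂW' + ℂY')` is defined over `K`; pull it back by `g₀`
    set T₀' : Submodule ℂ (Fin X₁.d₀ → ℂ) := S₁.map (LinearMap.fst ℂ _ _) with hT₀'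
    have hT₀'K : IsKRational K T₀' := by
      refine ⟨{c | ofK K (L := ℂ) c ∈ T₀'}, le_antisymm ?_ (span_le.mpr (by rintro _ ⟨c, hc, rfl⟩; exact hc))⟩
      rw [hT₀', hS₁, Submodule.map_span]
      refine span_le.mpr ?_
      rintro _ ⟨p, hp, rfl⟩
      have hp1 : ∀ i, p.1 i ∈ K := by
        rcases hp with hp | hp
        · exact (X₁.hW p hp).1
        · exact (X₁.hY p hp).1
      obtain ⟨c, hc⟩ := exists_ofK_of_mem K hp1
      refine subset_span ⟨c, ?_, hc.symm⟩
      simp only [Set.mem_setOf_eq]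
      rw [← hc]
      exact subset_span ⟨p, hp, rfl⟩
    have hT₀K : IsKRational K (T₀'.comap g₀) := IsKRational.comap_of_ofK g₀ g₀K hg₀K hT₀'K
    obtain ⟨htop, -⟩ := hirr (T₀'.comap g₀) ⊤ hT₀K ⟨Set.univ, ratSpan_univ.symm⟩
      (fun w hw => ⟨by
        rw [Submodule.mem_comap, hT₀']
        exact ⟨g w, hWS w hw, by rw [hgap]; rfl⟩, trivial⟩)
      (fun y hy => ⟨by
        rw [Submodule.mem_comap, hT₀']
        exact ⟨g y, hYS y hy, by rw [hgap]; rfl⟩, trivial⟩)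
    have hT₀'top : T₀' = ⊤ := by
      refine eq_top_iff.mpr fun u _ => ?_
      obtain ⟨u', rfl⟩ := hg₀surj u
      have : u' ∈ T₀'.comap g₀ := by rw [htop]; trivial
      exact this
    have h1 : Module.finrank ℂ T₀' ≤ Module.finrank ℂ S₁ := Submodule.finrank_map_le _ _
    rw [hT₀'top, finrank_top, Module.finrank_fin_fun] at h1
    exact h1
  · intro hn'0
    -- `W' = Y' = 0`, so `W, Y ⊆ ker g = ker g₀ × ker g₁`; hence `g = 0` and `d' = 0`
    have hS0 : S₁ = ⊥ := Submodule.finrank_eq_zero.mp hn'0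
    obtain ⟨s₁, hs₁⟩ := isKRational_ker_rat g₁ g₁₀ hg₁₀
    have hker : ∀ p, g p ∈ S₁ → p.1 ∈ LinearMap.ker g₀ ∧ p.2 ∈ LinearMap.ker g₁ := by
      intro p hp
      rw [hS0, Submodule.mem_bot, hgap, Prod.mk_eq_zero] at hp
      exact ⟨hp.1, hp.2⟩
    obtain ⟨hk0, hk1⟩ := hirr (LinearMap.ker g₀) (LinearMap.ker g₁) (isKRational_ker g₀ g₀K hg₀K) ⟨s₁, hs₁⟩
      (fun w hw => hker w (hWS w hw)) (fun y hy => hker y (hYS y hy))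
    have hV0 : ∀ q : (Fin X₁.d₀ → ℂ) × (Fin X₁.d₁ → ℂ), q = 0 := fun q => by
      obtain ⟨p, rfl⟩ := hsurj q
      rw [hgap, Prod.mk_eq_zero, ← LinearMap.mem_ker, ← LinearMap.mem_ker, hk0, hk1]
      exact ⟨trivial, trivial⟩
    constructor
    · by_contra h1
      obtain ⟨i⟩ : Nonempty (Fin X₁.d₀) := Fin.pos_iff_nonempty.mp (Nat.pos_of_ne_zero h1)
      have := congrFun (congrArg Prod.fst (hV0 (Pi.single i 1, 0))) i
      simp at this
    · by_contra h2
      obtain ⟨j⟩ : Nonempty (Fin X₁.d₁) := Fin.pos_iff_nonempty.mp (Nat.pos_of_ne_zero h2)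
      have := congrFun (congrArg Prod.snd (hV0 (0, Pi.single j 1))) j
      simp at this

/-! ### Théorème 1.1 from Théorème 5.1 -/

set_option maxHeartbeats 1600000 in
/-- **Théorème 1.1 of Roy–Waldschmidt 1997 for the field `K`, deduced from Théorème 5.1 for `K`**
(hypothesis `h51`, tangent-space form, see `…Sec6IVa.lean`) by the printed §6 argument
(Proposition 6.1 proved in `…Prop61.lean`, category `𝒞` and Lemmes 6.2–6.4 proved in
`…Sec6Cat/Fun/Eps/L62.lean`, Énoncé 1 in `…Sec6IVa.lean`, arithmetic in `…Sec6IVb.lean`).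
Statement: Théorème 1.1 verbatim (pp. 755–756) for this `K`, in the rendering of the hypothesis
`h11` of `…Thm11.lean`. [cite: RoyWaldschmidt1997ENS, Théorème 1.1 pp. 755–756; §6 (iv) (b) pp. 789–790] -/
theorem thm_1_1_of_h51
    (h51 : ∀ X : RWObj K, 0 < X.d₀ + X.d₁ →
      ∃ (d₀' d₁' : ℕ) (g : ((Fin X.d₀ → ℂ) × (Fin X.d₁ → ℂ)) →ₗ[ℂ] ((Fin d₀' → ℂ) × (Fin d₁' → ℂ))),
        IsStruct K g ∧ Function.Surjective g ∧
        (∀ z : Fin X.d₁ → ℤ, ∃ z' : Fin d₁' → ℤ, g (0, fun j => (z j : ℂ)) = (0, fun j => (z' j : ℂ))) ∧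
        0 < d₀' + d₁' ∧
        ∀ ε : ℝ, 0 < ε → ε ≤ 1 / (2 * ((X.d₀ : ℝ) + X.d₁) * (((X.d₀ : ℝ) + X.d₁) + ((X.ell₁ : ℝ) - X.kap)) + 1) →
          ((((X.d₀ : ℝ) + X.d₁) - 2 * X.nn) + ε * ((X.nn : ℝ) - X.d₀)) *
              ((d₁' : ℝ) + ((Module.finrank ℤ ↥(X.Y.map (g.restrictScalars ℤ)) : ℝ) -
                Module.finrank ℤ ↥(X.Y.map (g.restrictScalars ℤ) ⊓ omegaLattice d₀' d₁'))) ≤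
            (X.d₁ : ℝ) * ((((d₀' : ℝ) + d₁') - Module.finrank K ↥(X.W.map (g.restrictScalars K))) +
              ε * ((Module.finrank K ↥(X.W.map (g.restrictScalars K)) : ℝ) - d₀') -
              ε ^ 2 * ((Module.finrank ℤ ↥(X.Ya.map (g.restrictScalars ℤ)) : ℝ) -
                Module.finrank ℤ ↥(X.Ya.map (g.restrictScalars ℤ) ⊓ omegaLattice d₀' d₁'))))
    (d₀ d₁ : ℕ) (hd : 0 < d₀ + d₁)
    (W : Submodule K ((Fin d₀ → ℂ) × (Fin d₁ → ℂ)))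
    (hW : ∀ w ∈ W, (∀ i, w.1 i ∈ K) ∧ (∀ j, w.2 j ∈ K))
    (Y : Submodule ℤ ((Fin d₀ → ℂ) × (Fin d₁ → ℂ))) (hYfg : Y.FG)
    (hY : ∀ y ∈ Y, (∀ i, y.1 i ∈ K) ∧ (∀ j, cexp (y.2 j) ∈ K))
    (Ya : Submodule ℤ ((Fin d₀ → ℂ) × (Fin d₁ → ℂ))) (hYa : Ya ≤ Y)
    (hYaL : ∀ y ∈ Ya, ∀ j, IsAlgebraic ℚ (cexp (y.2 j)))
    (hn : 2 * Module.finrank ℂ (span ℂ ((W : Set ((Fin d₀ → ℂ) × (Fin d₁ → ℂ))) ∪ (Y : Set _))) < d₀ + d₁)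
    (hirr : ∀ (T₀ : Submodule ℂ (Fin d₀ → ℂ)) (T₁ : Submodule ℂ (Fin d₁ → ℂ)),
        IsKRational K T₀ → (∃ s : Set (Fin d₁ → ℚ), T₁ = ratSpan s) →
        (∀ w ∈ W, w.1 ∈ T₀ ∧ w.2 ∈ T₁) → (∀ y ∈ Y, y.1 ∈ T₀ ∧ y.2 ∈ T₁) → T₀ = ⊤ ∧ T₁ = ⊤) :
    ∃ (d₀' d₁' : ℕ) (g : ((Fin d₀ → ℂ) × (Fin d₁ → ℂ)) →ₗ[ℂ] ((Fin d₀' → ℂ) × (Fin d₁' → ℂ))),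
      0 < d₀' + d₁' ∧ Function.Surjective g ∧
      g '' {p | (∀ i, p.1 i ∈ K) ∧ p.2 = 0} = {q | (∀ i, q.1 i ∈ K) ∧ q.2 = 0} ∧
      g '' {p | p.1 = 0 ∧ ∀ j, p.2 j ∈ Set.range ((↑) : ℚ → ℂ)} =
        {q | q.1 = 0 ∧ ∀ j, q.2 j ∈ Set.range ((↑) : ℚ → ℂ)} ∧
      2 * Module.finrank ℂ (span ℂ ((W.map (g.restrictScalars K) : Set ((Fin d₀' → ℂ) × (Fin d₁' → ℂ))) ∪
            (Y.map (g.restrictScalars ℤ) : Set _))) < d₀' + d₁' ∧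
      Module.finrank K ↥(W.map (g.restrictScalars K)) <
        2 * Module.finrank ℂ (span ℂ ((W.map (g.restrictScalars K) : Set ((Fin d₀' → ℂ) × (Fin d₁' → ℂ))) ∪
            (Y.map (g.restrictScalars ℤ) : Set _))) ∧
      d₁' * (d₀ + d₁ - 2 * Module.finrank ℂ (span ℂ ((W : Set ((Fin d₀ → ℂ) × (Fin d₁ → ℂ))) ∪ (Y : Set _)))) ≤
        d₁ * (d₀' + d₁' - 2 * Module.finrank ℂ (span ℂ ((W.map (g.restrictScalars K) :
            Set ((Fin d₀' → ℂ) × (Fin d₁' → ℂ))) ∪ (Y.map (g.restrictScalars ℤ) : Set _)))) ∧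
      Module.finrank ℤ ↥(Y.map (g.restrictScalars ℤ)) *
          (d₀' + d₁' - 2 * Module.finrank ℂ (span ℂ ((W.map (g.restrictScalars K) :
            Set ((Fin d₀' → ℂ) × (Fin d₁' → ℂ))) ∪ (Y.map (g.restrictScalars ℤ) : Set _)))) ≤
        d₁' * (2 * Module.finrank ℂ (span ℂ ((W.map (g.restrictScalars K) :
            Set ((Fin d₀' → ℂ) × (Fin d₁' → ℂ))) ∪ (Y.map (g.restrictScalars ℤ) : Set _))) -
          Module.finrank K ↥(W.map (g.restrictScalars K))) ∧
      ((d₀' < Module.finrank ℂ (span ℂ ((W.map (g.restrictScalars K) :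
            Set ((Fin d₀' → ℂ) × (Fin d₁' → ℂ))) ∪ (Y.map (g.restrictScalars ℤ) : Set _))) ∨
        Module.finrank K ↥(W.map (g.restrictScalars K)) <
          Module.finrank ℂ (span ℂ ((W.map (g.restrictScalars K) :
            Set ((Fin d₀' → ℂ) × (Fin d₁' → ℂ))) ∪ (Y.map (g.restrictScalars ℤ) : Set _))) ∨
        0 < Module.finrank ℤ ↥(Ya.map (g.restrictScalars ℤ))) →
        Module.finrank ℤ ↥(Y.map (g.restrictScalars ℤ)) *
            (d₀' + d₁' - 2 * Module.finrank ℂ (span ℂ ((W.map (g.restrictScalars K) :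
              Set ((Fin d₀' → ℂ) × (Fin d₁' → ℂ))) ∪ (Y.map (g.restrictScalars ℤ) : Set _)))) <
          d₁' * (2 * Module.finrank ℂ (span ℂ ((W.map (g.restrictScalars K) :
              Set ((Fin d₀' → ℂ) × (Fin d₁' → ℂ))) ∪ (Y.map (g.restrictScalars ℤ) : Set _))) -
            Module.finrank K ↥(W.map (g.restrictScalars K)))) := by
  classical
  -- the object and the category `𝒞_ε`
  let X : RWObj K := ⟨d₀, d₁, W, hW, Y, hYfg, hY, Ya, hYa, hYaL⟩
  have hXn : X.nn = Module.finrank ℂ (span ℂ ((W : Set ((Fin d₀ → ℂ) × (Fin d₁ → ℂ))) ∪ (Y : Set _))) := rfl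
  set N : ℕ := 2 * X.dd * (X.dd + X.ell₁) + 1 with hN
  let Xc : Ceps K N := ⟨X, le_rfl⟩
  have hN1 : 1 ≤ N := by omega
  have hdd : X.dd = d₀ + d₁ := rfl
  -- `b_ε(X) > 0`
  have hbineq : (2 * N ^ 2 - N) * X.nn < (N ^ 2 - N) * X.dd₀ + N ^ 2 * X.dd₁ := by
    refine bE_pos_of_two_nn_lt (by rw [hXn]; exact hn) ?_
    show d₀ + d₁ + 1 ≤ N
    rw [hN, hdd]
    have : 1 ≤ d₀ + d₁ := hd
    nlinarith
  have hb : X.bE N ≠ 0 := by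
    simp only [RWObj.bE]; omega
  -- a minimiser `X₁` of `a/b` with `r` minimal
  have hbounds : ∀ X' : Ceps K N, Ceps.Quot Xc X' → X'.1.aE N ≤ N ^ 2 * X.dd ∧ X'.1.bE N ≤ N ^ 2 * X.dd := by
    intro X' hQ
    obtain ⟨Xs, hex⟩ := RoyWaldschmidt1997.quot_exists_exact (X := X) (X' := X'.1) hQ
    have hdadd := hex.dd_add
    have hd' : X'.1.dd ≤ X.dd := by omega
    refine ⟨?_, ?_⟩
    · simp only [RWObj.aE]
      refine Nat.mul_le_mul_left _ ?_
      have : X'.1.dd₁ ≤ X'.1.dd := Nat.le_add_left _ _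
      omega
    · refine (Ceps.bE_le_rE X').trans ?_
      simp only [RWObj.rE]
      exact Nat.mul_le_mul_left _ hd'
  obtain ⟨X₁, ⟨hQ₁, hb₁⟩, hmin₁, hrmin₁⟩ := RoyCategory.exists_min_ratio_min (Ob := Ceps K N)
    (fun X' => Ceps.Quot Xc X' ∧ X'.1.bE N ≠ 0) (fun X' => X'.1.aE N) (fun X' => X'.1.bE N) (fun X' => X'.1.rE N)
    (X₀ := Xc) ⟨Ceps.quot_refl Xc, hb⟩ (fun X' h => (hbounds X' h.1).1) (fun X' h => (hbounds X' h.1).2)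
    (fun X' h => Nat.pos_of_ne_zero h.2)
  -- `κ(X₁) = κ_a(X₁) = 0` (Lemme 6.4) and Énoncé 2 (Proposition 6.1 with Énoncé 1 from Théorème 5.1)
  have hk₁ : X₁.1.kap = 0 := Ceps.lemme_6_4 Xc X₁ hQ₁ hb₁ hmin₁ hrmin₁
  have hka₁ : X₁.1.kapA = 0 := by have := X₁.1.kapA_le_kap; omega
  have hE2 := (Ceps.enonce2_of_enonce1 (Ceps.enonce1_of_thm_5_1 h51) Xc hb).2 X₁ ⟨hQ₁, hb₁⟩ hmin₁ hrmin₁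
  have hab : X₁.1.aE N * X.bE N ≤ X.aE N * X₁.1.bE N := hmin₁ Xc ⟨Ceps.quot_refl Xc, hb⟩
  -- the underlying linear map
  obtain ⟨g, hcoker⟩ := hQ₁
  have hcoker' := hcoker
  obtain ⟨⟨hstruct, -, -, -⟩, hsurj, hWmap, hYmap, hYamap⟩ := hcoker'
  obtain ⟨himK, himQ⟩ := hstruct.image_eqs hsurj
  -- identify the primed quantities with the functions of `X₁`
  have eW : W.map (g.restrictScalars K) = X₁.1.W := hWmap
  have eY : Y.map (g.restrictScalars ℤ) = X₁.1.Y := hYmap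
  have eYa : Ya.map (g.restrictScalars ℤ) = X₁.1.Ya := hYamap
  have en' : Module.finrank ℂ (span ℂ ((W.map (g.restrictScalars K) : Set ((Fin X₁.1.d₀ → ℂ) × (Fin X₁.1.d₁ → ℂ))) ∪
      (Y.map (g.restrictScalars ℤ) : Set _))) = X₁.1.nn := by rw [eW, eY]; rfl
  have eℓ₀ : Module.finrank K ↥(W.map (g.restrictScalars K)) = X₁.1.ell₀ := by rw [eW]; rfl
  have eℓ₁ : Module.finrank ℤ ↥(Y.map (g.restrictScalars ℤ)) = X₁.1.ell₁ := by rw [eY]; rfl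
  have eℓa : Module.finrank ℤ ↥(Ya.map (g.restrictScalars ℤ)) = X₁.1.ellA := by rw [eYa]; rfl
  refine ⟨X₁.1.d₀, X₁.1.d₁, g, ?_, hsurj, himK, himQ, ?_⟩
  · -- `d' > 0`: otherwise `n(X₁) = 0`, `κ_a(X₁) = 0` and `b(X₁) = 0`
    by_contra h0
    push Not at h0
    have hd'0 : X₁.1.dd = 0 := by simp only [RWObj.dd]; omega
    have hn'0 : X₁.1.nn = 0 := by have := X₁.1.nn_le_dd; omega
    apply hb₁
    simp only [RWObj.bE, RWObj.dd₀, RWObj.dd₁, hka₁, hn'0, mul_zero, add_zero, Nat.sub_zero]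
    simp only [RWObj.dd] at hd'0
    have h1 : X₁.1.d₀ = 0 := by omega
    have h2 : X₁.1.d₁ = 0 := by omega
    simp [h1, h2]
  rw [en', eℓ₀, eℓ₁, eℓa, ← hXn]
  -- numerical data
  have hd'le : X₁.1.dd ≤ X.dd := by
    obtain ⟨Xs, hex⟩ := hcoker.exists_exact
    have := hex.dd_add
    change X.dd = Xs.dd + X₁.1.dd at this
    omega
  have hdN : X₁.1.dd < N := by
    refine lt_of_le_of_lt hd'le ?_
    have hXc2 : 2 * X.dd * (X.dd + X.ell₁) + 1 ≤ N := Xc.2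
    have : 1 ≤ X.dd := by rw [hdd]; exact hd
    nlinarith
  have hb₁ineq : (2 * N ^ 2 - N) * X₁.1.nn < (N ^ 2 - N) * X₁.1.dd₀ + N ^ 2 * X₁.1.dd₁ := by
    have : X₁.1.bE N ≠ 0 := hb₁
    simp only [RWObj.bE, hka₁, add_zero] at this
    omega
  -- `n' ≥ d₀'` and `n' > 0` from the hypothesis on `T₀ × T₁`
  obtain ⟨hn'd₀', hn'zero⟩ := quot_nn_facts X X₁.1 g hcoker hirr
  have hn'pos : 0 < X₁.1.nn := by
    by_contra h0
    push Not at h0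
    obtain ⟨h1, h2⟩ := hn'zero (Nat.le_zero.mp h0)
    have hn'0 : X₁.1.nn = 0 := Nat.le_zero.mp h0
    apply hb₁
    simp only [RWObj.bE, RWObj.dd₀, RWObj.dd₁, hka₁, hn'0, mul_zero, add_zero, Nat.sub_zero, h1, h2]
  -- `d' ≥ 2n'`, `d₁' ≥ n'`
  obtain ⟨h2n', hn'd₁'⟩ := dims_of_bE_pos hb₁ineq hn'd₀' hdN
  have hd₁'pos : 0 < X₁.1.dd₁ := lt_of_lt_of_le hn'pos hn'd₁'
  -- the left inequality of (6.5): from `a₁ b ≤ a b₁`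
  have hdE := Ceps.dE_exact X₁
  have hleft : (X₁.1.dd₁ : ℤ) * ((N : ℤ) ^ 2 * (X.dd₀ + X.dd₁ - 2 * X.nn) + N * (X.nn - X.dd₀)) ≤
      X.dd₁ * ((N : ℤ) ^ 2 * (X₁.1.dd₀ + X₁.1.dd₁ - 2 * X₁.1.nn) + N * (X₁.1.nn - X₁.1.dd₀)) := by
    have hab' := hab
    simp only [RWObj.aE, RWObj.bE, hk₁, hka₁, Nat.sub_zero, add_zero] at hab'
    exact left_input hN1 hbineq hb₁ineq X.kap_le_dd₁ hab'
  have hNbig : 2 * ((X.dd₀ : ℤ) + X.dd₁) ^ 2 < N := by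
    have : 2 * (d₀ + d₁) ^ 2 < N := by
      rw [hN, hdd]
      have : 1 ≤ d₀ + d₁ := hd
      nlinarith
    have h' : ((2 * (d₀ + d₁) ^ 2 : ℕ) : ℤ) < N := by exact_mod_cast this
    push_cast at h'
    exact h'
  obtain ⟨hL, h2n's⟩ := left_ineq_6_5 (N := (N : ℤ)) hNbig (Nat.cast_nonneg _) (Nat.cast_nonneg _) (Nat.cast_nonneg _)
    (Nat.cast_nonneg _) (by exact_mod_cast hd₁'pos) (by exact_mod_cast hn) (by
      have := hd'le; simp only [RWObj.dd] at this; exact_mod_cast this)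
    (by have := X₁.1.nn_le_dd; simp only [RWObj.dd] at this; exact_mod_cast this) hleft
  -- the right inequality of (6.5): from `c₁ b₁ ≤ a₁ d₁` when `ℓ₁' ≠ 0`
  have hℓ₀n : X₁.1.ell₀ ≤ X₁.1.nn := X₁.1.ell₀_le_nn
  have h2n'nat : 2 * X₁.1.nn < X₁.1.dd₀ + X₁.1.dd₁ := by exact_mod_cast h2n's
  have hright : (X₁.1.ell₁ : ℤ) * ((N : ℤ) ^ 2 * (X₁.1.dd₀ + X₁.1.dd₁ - 2 * X₁.1.nn) + N * (X₁.1.nn - X₁.1.dd₀)) ≤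
      X₁.1.dd₁ * ((N : ℤ) ^ 2 * (2 * X₁.1.nn - X₁.1.ell₀) - N * (X₁.1.nn - X₁.1.ell₀) - X₁.1.ellA) := by
    refine right_input hN1 hb₁ineq hdE fun hl => ?_
    have hc : X₁.1.cE N ≠ 0 := by
      simp only [RWObj.cE]; exact Nat.mul_ne_zero (by positivity) hl
    obtain ⟨-, -, hcd⟩ := hE2 hc
    simp only [RWObj.aE, RWObj.bE, RWObj.cE, RWObj.dE, hk₁, hka₁, Nat.sub_zero, add_zero] at hcd
    exact hcd
  obtain ⟨hR, hRs⟩ := right_ineq_6_5 (N := (N : ℤ)) (by exact_mod_cast hN1) (by exact_mod_cast hd₁'pos)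
    (Nat.cast_nonneg _) (Nat.cast_nonneg _) (by exact_mod_cast hn'd₀') (by exact_mod_cast hℓ₀n) h2n's
    (by exact_mod_cast hn'pos) hright
  -- assemble (back to `ℕ`)
  simp only [RWObj.dd₀, RWObj.dd₁] at h2n'nat hL hR hRs h2n's hn'd₀'
  have hsub1 : 2 * X.nn ≤ d₀ + d₁ := by rw [hXn]; exact hn.le
  refine ⟨h2n'nat, by omega, ?_, ?_, fun hor => ?_⟩
  · zify [hsub1, h2n'nat.le]
    simpa [RWObj.dd₀, RWObj.dd₁] using hL
  · zify [h2n'nat.le, (le_trans hℓ₀n (by omega) : X₁.1.ell₀ ≤ 2 * X₁.1.nn)]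
    exact hR
  · zify [h2n'nat.le, (le_trans hℓ₀n (by omega) : X₁.1.ell₀ ≤ 2 * X₁.1.nn)]
    refine hRs ?_
    rcases hor with h | h | h
    · exact Or.inl (by exact_mod_cast h)
    · exact Or.inr (Or.inl (by exact_mod_cast h))
    · exact Or.inr (Or.inr (by exact_mod_cast h))

end RoyWaldschmidt1997

end Literature.NumberTheory.Transcendental
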